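import Mathlib
import Summits.MatrixMultiplication.MatrixMultiplication.Theses.SemilatticeSTPP
import Summits.MatrixMultiplication.MatrixMultiplication.Theses.GroupTheoreticSTPP
import Summits.MatrixMultiplication.MatrixMultiplication.Theorems.SemilatticeSTPPThesisAbelianLift
import Summits.MatrixMultiplication.MatrixMultiplication.Theorems.SemilatticeSTPPThesisGroupHosts
import Literature.Computability.AlgebraicComplexity.GroupTheoreticMatMul

/-!
# Line `registered` of crux `SemilatticeSTPP.Thesis` (stmt-MatrixMultiplication-5969):
# `X_M` restricted to commutative GROUP hosts is exactly `X_C`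

The thesis `X_M` of route `SemilatticeSTPP` (`Theses.SemilatticeSTPP.Thesis`) asks, for every `ε > 0`, for a finite
commutative monoid `M` with every element regular and a MONOID-TPP family (iff-form, indexed exactly like
`matMulDirectSum`: `α x · β y = γ z ⟺` the three block indices agree and the coordinates match) with
`|M| < Σᵢ (aᵢ bᵢ cᵢ)^((2+ε)/3)`.  The thesis `X_C` of route `GroupTheoreticSTPP`
(`Theses.GroupTheoreticSTPP.CThesis`) asks for the same beat by an STPP family `(Aᵢ, Bᵢ, Cᵢ)_{i<N}` of finsets in a
finite ADDITIVE abelian group `H` (Cohn–Kleinberg–Szegedy–Umans 2005, Def. 5.1, additive form; the tree predicate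
`Literature.Computability.AlgebraicComplexity.IsSTPP`, unfolded by `isSTPP_iff`).

This file records that the sub-thesis of `X_M` in which the host is required to be a finite commutative GROUP is
literally equivalent to `X_C`:

* `exists_commGroup_family_of_isSTPP` — (`X_C ⇒` group hosts) an STPP family in `H` beating `|H|` at exponent `τ` is a
  monoid-TPP family of the same shapes `(|A i|, |B i|, |C i|)` in the commutative group `Multiplicative H`, beating
  `|Multiplicative H| = |H|` at `τ`: enumerate `A i, B i, C i` by `Finset.equivFin` and put `α ⟨i,(s,t)⟩ := S − T`,
  `β ⟨i,(t,u)⟩ := T − U`, `γ ⟨i,(s,u)⟩ := S − U` (written multiplicatively); `α x · β y = γ z` reads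
  `(S' − S) + (T' − T) + (U' − U) = 0`, the binder pattern of `IsSTPP` (same construction as
  `thesisBodyAt_of_isSTPP` of `…Theorems/SemilatticeSTPPThesisAbelianLift.lean`, which packages the host only as a
  commutative monoid).
* `thesis_commGroupHosts_iff_cThesis` — the equivalence.  (group hosts `⇒ X_C`): the group-host normal form
  `isSTPP_of_tppFamily_commGroup` of `…Theorems/SemilatticeSTPPThesisGroupHosts.lean` turns a monoid-TPP family in a
  commutative group `G` into an STPP family in `Additive G` with the same block volumes, so the beat transfers
  verbatim (`|Additive G| = |G|`).

Mathlib + the five tree files above; sorry-free; no new definitions (all data are existential witnesses).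
-/

set_option linter.dupNamespace false
-- (single-conjunct summit: the namespace repeats `MatrixMultiplication`)

namespace Summit.MatrixMultiplication.MatrixMultiplication.Theorems.SemilatticeSTPPThesis

open Literature.Computability.AlgebraicComplexity

/-- **Abelian lift with a GROUP host.**  Every STPP family `(A i, B i, C i)_{i<N}` in a finite additive abelian group
`H` (CKSU 2005 Def. 5.1 / BCCGNSU 2017 Def. 2.2, tree predicate `IsSTPP`) yields a monoid-TPP family (iff-form) of
shapes `(|A i|, |B i|, |C i|)` in the finite commutative group `Multiplicative H`; consequently, at every exponent `τ`
with `|H| < Σᵢ (|A i| |B i| |C i|)^τ`, some finite commutative group hosts a monoid-TPP family beating its order at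
`τ`.  Same construction as `thesisBodyAt_of_isSTPP` (which only remembers a commutative monoid).
[cite: CohnKleinbergSzegedyUmans2005, Def. 5.1] -/
theorem exists_commGroup_family_of_isSTPP :
    ∀ (H : Type) [AddCommGroup H] [Fintype H] (N : ℕ) (A B C : Fin N → Finset H),
      Literature.Computability.AlgebraicComplexity.IsSTPP A B C → ∀ τ : ℝ,
      (Fintype.card H : ℝ) < ∑ i, (((A i).card * (B i).card * (C i).card : ℕ) : ℝ) ^ τ →
      ∃ (G : Type) (_ : CommGroup G) (_ : Fintype G) (p : ℕ) (a b c : Fin p → ℕ)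
        (α : (Σ i, Fin (a i) × Fin (b i)) → G) (β : (Σ i, Fin (b i) × Fin (c i)) → G)
        (γ : (Σ i, Fin (a i) × Fin (c i)) → G),
        (∀ x y z, α x * β y = γ z ↔
          (z.1 = x.1 ∧ x.1 = y.1 ∧ (z.2.1 : ℕ) = x.2.1 ∧ (x.2.2 : ℕ) = y.2.1 ∧ (z.2.2 : ℕ) = y.2.2)) ∧
        (Fintype.card G : ℝ) < ∑ i, ((a i * b i * c i : ℕ) : ℝ) ^ τ := by
  intro H _ _ N A B C hS τ hlt
  -- injective enumerations of the finsets `A i`, `B i`, `C i` by `Fin (card)`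
  obtain ⟨eA, hAmem, hAinj⟩ : ∃ e : ∀ i, Fin (A i).card → H,
      (∀ i s, e i s ∈ A i) ∧ ∀ i, Function.Injective (e i) :=
    ⟨fun i s => ((A i).equivFin.symm s : H), fun i s => Finset.coe_mem _,
      fun i s s' h => (A i).equivFin.symm.injective (Subtype.ext h)⟩
  obtain ⟨eB, hBmem, hBinj⟩ : ∃ e : ∀ i, Fin (B i).card → H,
      (∀ i t, e i t ∈ B i) ∧ ∀ i, Function.Injective (e i) :=
    ⟨fun i t => ((B i).equivFin.symm t : H), fun i t => Finset.coe_mem _,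
      fun i t t' h => (B i).equivFin.symm.injective (Subtype.ext h)⟩
  obtain ⟨eC, hCmem, hCinj⟩ : ∃ e : ∀ i, Fin (C i).card → H,
      (∀ i u, e i u ∈ C i) ∧ ∀ i, Function.Injective (e i) :=
    ⟨fun i u => ((C i).equivFin.symm u : H), fun i u => Finset.coe_mem _,
      fun i u u' h => (C i).equivFin.symm.injective (Subtype.ext h)⟩
  refine ⟨Multiplicative H, inferInstance, inferInstance, N,
    fun i => (A i).card, fun i => (B i).card, fun i => (C i).card,
    fun x => Multiplicative.ofAdd (eA x.1 x.2.1 - eB x.1 x.2.2),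
    fun y => Multiplicative.ofAdd (eB y.1 y.2.1 - eC y.1 y.2.2),
    fun z => Multiplicative.ofAdd (eA z.1 z.2.1 - eC z.1 z.2.2), ?_, ?_⟩
  · rintro ⟨i, s, t⟩ ⟨j, t', u⟩ ⟨k, s', u'⟩
    dsimp only
    constructor
    · intro h
      rw [← ofAdd_add] at h
      have h' : (eA i s - eB i t) + (eB j t' - eC j u) = eA k s' - eC k u' := Multiplicative.ofAdd.injective h
      have key : (eA i s - eA k s') + (eB j t' - eB i t) + (eC k u' - eC j u) = 0 := by
        rw [← sub_eq_zero.mpr h']; abel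
      obtain ⟨rfl, rfl, hs, ht, hu⟩ := hS i j k _ (hAmem k s') _ (hAmem i s) _ (hBmem i t) _ (hBmem j t')
        _ (hCmem j u) _ (hCmem k u') key
      obtain rfl := hAinj i hs
      obtain rfl := hBinj i ht
      obtain rfl := hCinj i hu
      exact ⟨rfl, rfl, rfl, rfl, rfl⟩
    · rintro ⟨h₁, h₂, h₃, h₄, h₅⟩
      subst h₁ h₂
      obtain rfl := Fin.ext h₃
      obtain rfl := Fin.ext h₄
      obtain rfl := Fin.ext h₅
      rw [← ofAdd_add]
      congr 1
      abel
  · rw [Fintype.card_multiplicative]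
    exact hlt

/-- **`X_M` on commutative group hosts `= X_C`.**  The restriction of the thesis of route `SemilatticeSTPP` to finite
commutative GROUP hosts — for every `ε > 0` a finite commutative group `G` and a monoid-TPP family (iff-form) with
`|G| < Σᵢ (aᵢ bᵢ cᵢ)^((2+ε)/3)` — is equivalent to the thesis `CThesis` of route `GroupTheoreticSTPP` (STPP families
in finite abelian groups beating `|H|` at exponent `(2+ε)/3`, Cohn–Kleinberg–Szegedy–Umans 2005, Def. 5.1).
(`⇒`) group-host normal form `isSTPP_of_tppFamily_commGroup` in `Additive G` (same block volumes);
(`⇐`) abelian lift `exists_commGroup_family_of_isSTPP` in `Multiplicative H`.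
[cite: CohnKleinbergSzegedyUmans2005, Def. 5.1] -/
theorem thesis_commGroupHosts_iff_cThesis :
    (∀ ε : ℝ, 0 < ε → ∃ (G : Type) (_ : CommGroup G) (_ : Fintype G) (p : ℕ) (a b c : Fin p → ℕ)
        (α : (Σ i, Fin (a i) × Fin (b i)) → G) (β : (Σ i, Fin (b i) × Fin (c i)) → G)
        (γ : (Σ i, Fin (a i) × Fin (c i)) → G),
        (∀ x y z, α x * β y = γ z ↔
          (z.1 = x.1 ∧ x.1 = y.1 ∧ (z.2.1 : ℕ) = x.2.1 ∧ (x.2.2 : ℕ) = y.2.1 ∧ (z.2.2 : ℕ) = y.2.2)) ∧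
        (Fintype.card G : ℝ) < ∑ i, ((a i * b i * c i : ℕ) : ℝ) ^ ((2 + ε) / 3)) ↔
    Summit.MatrixMultiplication.MatrixMultiplication.Theses.GroupTheoreticSTPP.CThesis := by
  constructor
  · -- group hosts `⇒ X_C`: normal form in `Additive G`, volumes preserved blockwise
    intro h ε hε
    obtain ⟨G, _, _, p, a, b, c, α, β, γ, hαβγ, hlt⟩ := h ε hε
    obtain ⟨A, B, C, hS, hvol⟩ := isSTPP_of_tppFamily_commGroup G p a b c α β γ hαβγ
    refine ⟨Additive G, inferInstance, inferInstance, p, A, B, C, (isSTPP_iff A B C).1 hS, ?_⟩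
    rw [Fintype.card_additive]
    calc (Fintype.card G : ℝ) < ∑ i, ((a i * b i * c i : ℕ) : ℝ) ^ ((2 + ε) / 3) := hlt
      _ = ∑ i, (((A i).card * (B i).card * (C i).card : ℕ) : ℝ) ^ ((2 + ε) / 3) :=
        Finset.sum_congr rfl fun i _ => by rw [hvol i]
  · -- `X_C ⇒` group hosts: abelian lift in `Multiplicative H`
    intro hC ε hε
    obtain ⟨H, _, _, N, A, B, C, hS, hlt⟩ := hC ε hε
    exact exists_commGroup_family_of_isSTPP H N A B C ((isSTPP_iff A B C).2 hS) _ hlt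

end Summit.MatrixMultiplication.MatrixMultiplication.Theorems.SemilatticeSTPPThesis
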